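import Mathlib
import HarnessLib
import Summits.HubbardSuperconductivity.HubbardSuperconductivity.Theorems.KLProgrammeKLRegimeEngineScaleZeroSmearingSecondOrder
import Summits.HubbardSuperconductivity.HubbardSuperconductivity.Theorems.KLProgrammeKLRegimeEngineScaleZeroSmearingVertexBounds

/-!
# K3 ENGINE-FLOW child (stmt-HubbardSuperconductivity-20437 `KLRegimeEngineV17F2`), located «(X).2′-BASE-ROOM», cure (β) «SCALE0-MEMBER-DIFF», part F3:
# THE SECOND-ORDER MEMBER DIFFERENCE IS BOUNDED IN MOMENTUM SPACE — `960·c_U²·sup‖s_C‖·Σ‖s_d‖` at every string, `40·U²·sup‖s_C‖·Σ‖s_d‖/|βL²|³` at the pair legs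

Cell `gate-hubbard-kl`, seat hubbard-kl-k3c5-p1 (g22).  F1 (`…SmearingSecondOrder`): `kernel₄(e^{Δ_{D+d}}𝒱₀ − e^{Δ_D}𝒱₀) = −½·[4·(trees over the d-tadpole)
− 2·4!·(d ⊗ C bubbles)] + tail`.  F2 (`…SmearingVertexBounds`): `‖kernel V_U 4‖ ≤ c_U = |U|/|βL²|³/24` everywhere, one-leg sums `≤ 4c_U`, normal-line entry
sums.  Here, for NORMAL hard and soft lines `C = normalCovariance s_C`, `d = normalCovariance s_d` (every cutoff covariance `C^K_{>Λ}`, every soft member and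
every member difference is of this form) and ANY smearing `D`:

* §1 `sum_norm_kernel_two_laplacian_le` — the `d`-tadpole column `Σ_X ‖kernel (Δ_d W) 2 (X, Z)‖ ≤ 48·c_U·Σ_p‖s_d p‖`;
* §2 `norm_oneLineTree_le` — each tree `≤ 48·c_U²·S_C·Σ‖s_d‖`; §3 `norm_softHardBubble_le` — each bubble `≤ 8·c_U²·S_C·Σ‖s_d‖` (`S_C ≥ sup‖s_C‖`);
* §4 **`norm_kernel_four_gaussConv_add_effAction_sub_sub_tail_le`** — `‖kernel₄(e^{Δ_{D+d}}𝒱₀ − e^{Δ_D}𝒱₀) Z − tail Z‖ ≤ 960·c_U²·S_C·Σ_p‖s_d p‖` at EVERY `Z`;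
* §5 **`norm_klCovSmearedPairAmplitude_zero_add_sub_sub_tail_le`** — at the pair legs, in vertex-function units:
  `‖𝒜₀[D+d] − 𝒜₀[D] − 4!(βL²)³·tail‖ ≤ 40·U²·S_C·(Σ_p‖s_d p‖)/|βL²|³` — NO position-space `ℓ¹` constant, no determinant bound: the hard line enters by its SUP,
  the soft difference by its entry sum (`= βL² ×` its phase-space mass).

Part F4 bounds the tail (`e^{Δ}T₃`, pure `|U|³`); F5 puts `s_C = uvSymbolCT` (`sup ≤ βL²·2/e₀`-type) and `s_d` = the member-difference symbol.  Nothing here asserts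
row (X), any stub of 20437, K3, U₀ or superconductivity.  References: Salmhofer 1999 §2.4, §4.3 [cite: Salmhofer1999]; BGM 2006 §2.2 (2.12)–(2.14)
[cite: BenfattoGiulianiMastropietro2006].
-/

noncomputable section

namespace Summit.HubbardSuperconductivity.HubbardSuperconductivity.Theorems.EngineV8

set_option linter.dupNamespace false -- summit = problem name (single-conjunct summit), D-0017

open Literature.MathematicalPhysics.QuantumLattice Literature.Probability.LatticeModels GrassmannAlgebra Finset Matrix
open Summit.HubbardSuperconductivity.HubbardSuperconductivity.Theorems.KLRegimeWick
open Summit.HubbardSuperconductivity.HubbardSuperconductivity.Theorems.KLRegimeSplit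
open Summit.HubbardSuperconductivity.HubbardSuperconductivity.Theorems.KLProgrammeLegKernels
open Summit.HubbardSuperconductivity.HubbardSuperconductivity.Theorems.C4a

variable {L M : ℕ} [NeZero L] [NeZero M]

/-! ## §1 The `d`-tadpole column -/

omit [NeZero L] [NeZero M] in
/-- `snoc (snoc (u, v) B) A = (u, v, B, A)`. -/
theorem snoc_snoc_vec_two {α : Type*} (u v B A : α) : (Fin.snoc (Fin.snoc ![u, v] B : Fin 3 → α) A : Fin 4 → α) = ![u, v, B, A] := by
  funext i; fin_cases i <;> rfl

omit [NeZero L] [NeZero M] in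
/-- `‖((3·4/2 : ℚ) • 1 : ℂ)‖ = 6` (the pair-position count of `kernel_grassmannLaplacian` in degree `2`). -/
theorem norm_pairPositions_deg_two : ‖(((((2 + 1) * (2 + 2) : ℕ) : ℚ) / 2) • (1 : ℂ))‖ = 6 := by
  rw [show ((((2 + 1) * (2 + 2) : ℕ) : ℚ) / 2) = (6 : ℚ) by norm_num, Rat.smul_one_eq_cast, Rat.cast_ofNat]
  exact RCLike.norm_ofNat 6

omit [NeZero M] in
/-- **The `d`-tadpole two-leg kernel, one leg summed**: for `d = normalCovariance s_d` and `W = V_U + 𝒩_K`,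
`Σ_X ‖kernel (Δ_d W) 2 (X, Z)‖ ≤ 48·(|U|/|βL²|³/24)·Σ_p ‖s_d p‖` (`kernel (Δ_d W) 2 (X,Z) = 6·Σ_A d(A,Ā)·kernel V_U 4 (X, Z, Ā, A)`, then the slot-`0` sparsity).
[cite: Salmhofer1999, §4.3.2 (4.86)] -/
theorem sum_norm_kernel_two_laplacian_le (β U : ℝ) (K : TrigPolyC4v) (sd : FreqMomentum L M × Fin 2 → ℂ) (Z : HubbardFieldIdx L M) :
    ∑ X : HubbardFieldIdx L M, ‖kernel ℂ (grassmannLaplacian ℂ (normalCovariance L M sd) (hubbardInteractionCT L M β U K)) 2 ![X, Z]‖ ≤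
      48 * (|U| / |β * (L : ℝ) ^ 2| ^ 3 / 24) * ∑ p, ‖sd p‖ := by
  set cU : ℝ := |U| / |β * (L : ℝ) ^ 2| ^ 3 / 24 with hcU
  -- the kernel as `c₆ · Σ_A d(A,Ā)·kernel V_U 4 (X, Z, Ā, A)`
  have hker : ∀ X : HubbardFieldIdx L M,
      kernel ℂ (grassmannLaplacian ℂ (normalCovariance L M sd) (hubbardInteractionCT L M β U K)) 2 ![X, Z] =
        ((((((2 + 1) * (2 + 2) : ℕ) : ℚ) / 2) • (1 : ℂ))) * ∑ A : HubbardFieldIdx L M, normalCovariance L M sd A (A.1, 1 - A.2) *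
          kernel ℂ (hubbardInteraction L M β U) 4 ![X, Z, (A.1, 1 - A.2), A] := by
    intro X
    rw [kernel_grassmannLaplacian]
    congr 1
    refine sum_congr rfl fun A _ => ?_
    rw [Finset.sum_eq_single (A.1, 1 - A.2) (fun B _ hB => by rw [normalCovariance_eq_zero_of_ne_bar sd A B hB, zero_mul])
      (fun h => absurd (mem_univ _) h), snoc_snoc_vec_two, kernel_hubbardInteractionCT_four]
  have hpt : ∀ X : HubbardFieldIdx L M,
      ‖kernel ℂ (grassmannLaplacian ℂ (normalCovariance L M sd) (hubbardInteractionCT L M β U K)) 2 ![X, Z]‖ ≤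
        6 * ∑ A : HubbardFieldIdx L M, ‖normalCovariance L M sd A (A.1, 1 - A.2)‖ * ‖kernel ℂ (hubbardInteraction L M β U) 4 ![X, Z, (A.1, 1 - A.2), A]‖ := by
    intro X
    rw [hker X, norm_mul, norm_pairPositions_deg_two]
    refine mul_le_mul_of_nonneg_left ((norm_sum_le _ _).trans (le_of_eq (sum_congr rfl fun A _ => norm_mul _ _))) (by norm_num)
  calc ∑ X : HubbardFieldIdx L M, ‖kernel ℂ (grassmannLaplacian ℂ (normalCovariance L M sd) (hubbardInteractionCT L M β U K)) 2 ![X, Z]‖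
      ≤ ∑ X : HubbardFieldIdx L M, 6 * ∑ A : HubbardFieldIdx L M,
          ‖normalCovariance L M sd A (A.1, 1 - A.2)‖ * ‖kernel ℂ (hubbardInteraction L M β U) 4 ![X, Z, (A.1, 1 - A.2), A]‖ := sum_le_sum fun X _ => hpt X
    _ = 6 * ∑ A : HubbardFieldIdx L M, ‖normalCovariance L M sd A (A.1, 1 - A.2)‖ *
          ∑ X : HubbardFieldIdx L M, ‖kernel ℂ (hubbardInteraction L M β U) 4 ![X, Z, (A.1, 1 - A.2), A]‖ := by
        rw [← mul_sum, sum_comm]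
        simp_rw [mul_sum]
    _ ≤ 6 * ∑ A : HubbardFieldIdx L M, ‖normalCovariance L M sd A (A.1, 1 - A.2)‖ * (4 * cU) := by
        refine mul_le_mul_of_nonneg_left (sum_le_sum fun A _ => mul_le_mul_of_nonneg_left ?_ (norm_nonneg _)) (by norm_num)
        exact sum_norm_kernel_hubbardInteraction_slot_zero_le β U Z (A.1, 1 - A.2) A
    _ = 48 * cU * ∑ p, ‖sd p‖ := by rw [← sum_mul, sum_norm_normalCovariance_bar]; ring

/-! ## §2 One hard-line tree over the `d`-tadpole -/

/-- **A one-hard-line tree is small**: for `C = normalCovariance s_C` with `‖s_C p‖ ≤ S_C` and `d = normalCovariance s_d`,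
`‖Σ_{X,Y} contr C X Y·kernel (Δ_d W) 2 (X, Z₀)·kernel V_U 4 (Y, Z₁, Z₂, Z₃)‖ ≤ 48·c_U²·S_C·Σ_p‖s_d p‖`. [cite: Salmhofer1999, §2.4] -/
theorem norm_oneLineTree_le (β U : ℝ) (K : TrigPolyC4v) (sC sd : FreqMomentum L M × Fin 2 → ℂ) {SC : ℝ} (hSC : ∀ p, ‖sC p‖ ≤ SC)
    (Z₀ Z₁ Z₂ Z₃ : HubbardFieldIdx L M) :
    ‖∑ X, ∑ Y, contr ℂ (normalCovariance L M sC) X Y *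
        (kernel ℂ (grassmannLaplacian ℂ (normalCovariance L M sd) (hubbardInteractionCT L M β U K)) 2 ![X, Z₀] *
          kernel ℂ (hubbardInteraction L M β U) 4 ![Y, Z₁, Z₂, Z₃])‖ ≤
      48 * (|U| / |β * (L : ℝ) ^ 2| ^ 3 / 24) ^ 2 * SC * ∑ p, ‖sd p‖ := by
  set cU : ℝ := |U| / |β * (L : ℝ) ^ 2| ^ 3 / 24 with hcU
  have hcU0 : 0 ≤ cU := by positivity
  have hSC0 : 0 ≤ SC := (norm_nonneg _).trans (hSC ((omega0 M, 0), 0))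
  -- termwise
  have hrow : ∀ X : HubbardFieldIdx L M,
      ‖∑ Y, contr ℂ (normalCovariance L M sC) X Y *
          (kernel ℂ (grassmannLaplacian ℂ (normalCovariance L M sd) (hubbardInteractionCT L M β U K)) 2 ![X, Z₀] *
            kernel ℂ (hubbardInteraction L M β U) 4 ![Y, Z₁, Z₂, Z₃])‖ ≤
        ‖kernel ℂ (grassmannLaplacian ℂ (normalCovariance L M sd) (hubbardInteractionCT L M β U K)) 2 ![X, Z₀]‖ * (SC * cU) := by
    intro X
    calc _ ≤ ∑ Y, ‖contr ℂ (normalCovariance L M sC) X Y‖ *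
          (‖kernel ℂ (grassmannLaplacian ℂ (normalCovariance L M sd) (hubbardInteractionCT L M β U K)) 2 ![X, Z₀]‖ * cU) := by
          refine (norm_sum_le _ _).trans (sum_le_sum fun Y _ => ?_)
          rw [norm_mul, norm_mul]
          exact mul_le_mul_of_nonneg_left (mul_le_mul_of_nonneg_left (norm_kernel_hubbardInteraction_four_le β U _) (norm_nonneg _)) (norm_nonneg _)
      _ = (∑ Y, ‖contr ℂ (normalCovariance L M sC) X Y‖) *
          (‖kernel ℂ (grassmannLaplacian ℂ (normalCovariance L M sd) (hubbardInteractionCT L M β U K)) 2 ![X, Z₀]‖ * cU) := by rw [sum_mul]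
      _ ≤ SC * (‖kernel ℂ (grassmannLaplacian ℂ (normalCovariance L M sd) (hubbardInteractionCT L M β U K)) 2 ![X, Z₀]‖ * cU) :=
          mul_le_mul_of_nonneg_right ((sum_norm_contr_normalCovariance_le sC X).trans (hSC _)) (by positivity)
      _ = _ := by ring
  calc _ ≤ ∑ X, ‖kernel ℂ (grassmannLaplacian ℂ (normalCovariance L M sd) (hubbardInteractionCT L M β U K)) 2 ![X, Z₀]‖ * (SC * cU) :=
        (norm_sum_le _ _).trans (sum_le_sum fun X _ => hrow X)
    _ ≤ (48 * cU * ∑ p, ‖sd p‖) * (SC * cU) := by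
        rw [← sum_mul]
        exact mul_le_mul_of_nonneg_right (sum_norm_kernel_two_laplacian_le β U K sd Z₀) (by positivity)
    _ = 48 * cU ^ 2 * SC * ∑ p, ‖sd p‖ := by ring

/-! ## §3 One hard–soft bubble -/

/-- **A hard–soft bubble is small**: for `d = normalCovariance s_d`, `C = normalCovariance s_C`, `‖s_C p‖ ≤ S_C`, and any four fixed legs,
`‖Σ_{X,Y,X′,Y′} contr d X Y·contr C X′ Y′·kernel V_U 4 (X,X′,Z_a,Z_b)·kernel V_U 4 (Y,Y′,Z_c,Z_e)‖ ≤ 8·c_U²·S_C·Σ_p‖s_d p‖` — the soft line by its entry sum, the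
free hard leg by sparsity, the hard line by its sup, the last vertex by its size. [cite: Salmhofer1999, §2.4] -/
theorem norm_softHardBubble_le (β U : ℝ) (sC sd : FreqMomentum L M × Fin 2 → ℂ) {SC : ℝ} (hSC : ∀ p, ‖sC p‖ ≤ SC)
    (Za Zb Zc Ze : HubbardFieldIdx L M) :
    ‖∑ X, ∑ Y, ∑ X', ∑ Y', contr ℂ (normalCovariance L M sd) X Y * contr ℂ (normalCovariance L M sC) X' Y' *
        (kernel ℂ (hubbardInteraction L M β U) 4 ![X, X', Za, Zb] * kernel ℂ (hubbardInteraction L M β U) 4 ![Y, Y', Zc, Ze])‖ ≤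
      8 * (|U| / |β * (L : ℝ) ^ 2| ^ 3 / 24) ^ 2 * SC * ∑ p, ‖sd p‖ := by
  set cU : ℝ := |U| / |β * (L : ℝ) ^ 2| ^ 3 / 24 with hcU
  have hcU0 : 0 ≤ cU := by positivity
  have hSC0 : 0 ≤ SC := (norm_nonneg _).trans (hSC ((omega0 M, 0), 0))
  -- innermost: the hard line's row at `X′` against the last vertex
  have hin : ∀ (X' Y : HubbardFieldIdx L M),
      ∑ Y', ‖contr ℂ (normalCovariance L M sC) X' Y'‖ * ‖kernel ℂ (hubbardInteraction L M β U) 4 ![Y, Y', Zc, Ze]‖ ≤ SC * cU := by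
    intro X' Y
    calc _ ≤ ∑ Y', ‖contr ℂ (normalCovariance L M sC) X' Y'‖ * cU :=
          sum_le_sum fun Y' _ => mul_le_mul_of_nonneg_left (norm_kernel_hubbardInteraction_four_le β U _) (norm_nonneg _)
      _ ≤ SC * cU := by
          rw [← sum_mul]
          exact mul_le_mul_of_nonneg_right ((sum_norm_contr_normalCovariance_le sC X').trans (hSC _)) hcU0
  -- middle: the free hard leg `X′` by sparsity
  have hmid : ∀ (X Y : HubbardFieldIdx L M),
      ∑ X', ∑ Y', ‖contr ℂ (normalCovariance L M sC) X' Y'‖ *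
          (‖kernel ℂ (hubbardInteraction L M β U) 4 ![X, X', Za, Zb]‖ * ‖kernel ℂ (hubbardInteraction L M β U) 4 ![Y, Y', Zc, Ze]‖) ≤
        4 * cU * (SC * cU) := by
    intro X Y
    calc _ = ∑ X', ‖kernel ℂ (hubbardInteraction L M β U) 4 ![X, X', Za, Zb]‖ *
          ∑ Y', ‖contr ℂ (normalCovariance L M sC) X' Y'‖ * ‖kernel ℂ (hubbardInteraction L M β U) 4 ![Y, Y', Zc, Ze]‖ := by
          refine sum_congr rfl fun X' _ => ?_
          rw [mul_sum]
          exact sum_congr rfl fun Y' _ => by ring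
      _ ≤ ∑ X', ‖kernel ℂ (hubbardInteraction L M β U) 4 ![X, X', Za, Zb]‖ * (SC * cU) :=
          sum_le_sum fun X' _ => mul_le_mul_of_nonneg_left (hin X' Y) (norm_nonneg _)
      _ ≤ 4 * cU * (SC * cU) := by
          rw [← sum_mul]
          exact mul_le_mul_of_nonneg_right (sum_norm_kernel_hubbardInteraction_slot_one_le β U X Za Zb) (by positivity)
  calc _ ≤ ∑ X, ∑ Y, ‖contr ℂ (normalCovariance L M sd) X Y‖ * ∑ X', ∑ Y', ‖contr ℂ (normalCovariance L M sC) X' Y'‖ *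
          (‖kernel ℂ (hubbardInteraction L M β U) 4 ![X, X', Za, Zb]‖ * ‖kernel ℂ (hubbardInteraction L M β U) 4 ![Y, Y', Zc, Ze]‖) := by
        refine (norm_sum_le _ _).trans (sum_le_sum fun X _ => (norm_sum_le _ _).trans (sum_le_sum fun Y _ => ?_))
        rw [mul_sum]
        refine (norm_sum_le _ _).trans (sum_le_sum fun X' _ => ?_)
        rw [mul_sum]
        refine (norm_sum_le _ _).trans (sum_le_sum fun Y' _ => le_of_eq ?_)
        rw [norm_mul, norm_mul, norm_mul]
        ring
    _ ≤ ∑ X, ∑ Y, ‖contr ℂ (normalCovariance L M sd) X Y‖ * (4 * cU * (SC * cU)) :=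
        sum_le_sum fun X _ => sum_le_sum fun Y _ => mul_le_mul_of_nonneg_left (hmid X Y) (norm_nonneg _)
    _ = (∑ X, ∑ Y, ‖contr ℂ (normalCovariance L M sd) X Y‖) * (4 * cU * (SC * cU)) := by
        rw [Finset.sum_mul]
        exact sum_congr rfl fun X _ => (Finset.sum_mul _ _ _).symm
    _ ≤ (2 * ∑ p, ‖sd p‖) * (4 * cU * (SC * cU)) :=
        mul_le_mul_of_nonneg_right (sum_sum_norm_contr_normalCovariance_le sd) (by positivity)
    _ = 8 * cU ^ 2 * SC * ∑ p, ‖sd p‖ := by ring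

/-! ## §4 The explicit second-order member difference at every string -/

/-- **THE SECOND-ORDER MEMBER DIFFERENCE IS SMALL AT EVERY STRING**: for normal lines `C = normalCovariance s_C` (`‖s_C p‖ ≤ S_C`),
`d = normalCovariance s_d`, any smearing `D`, `W = V_U + 𝒩_K`, `𝒱₀ = effAction C W`, and every `Z`,
`‖kernel₄(e^{Δ_{D+d}}𝒱₀ − e^{Δ_D}𝒱₀) Z − [kernel₄(e^{Δ_{D+d}}T₃) Z − kernel₄(e^{Δ_D}T₃) Z]‖ ≤ 960·(|U|/|βL²|³/24)²·S_C·Σ_p‖s_d p‖`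
(F1's explicit form: four trees `≤ 48`, three bubbles `≤ 8`, weights `½·4` and `½·2·4!`). [cite: BenfattoGiulianiMastropietro2006, §2.2 (2.12)-(2.14)] -/
theorem norm_kernel_four_gaussConv_add_effAction_sub_sub_tail_le (β U : ℝ) (K : TrigPolyC4v) (sC sd : FreqMomentum L M × Fin 2 → ℂ) {SC : ℝ}
    (hSC : ∀ p, ‖sC p‖ ≤ SC) (D : Matrix (HubbardFieldIdx L M) (HubbardFieldIdx L M) ℂ) (Z : Fin 4 → HubbardFieldIdx L M) :
    ‖kernel ℂ (gaussConv ℂ (D + normalCovariance L M sd) (effAction ℂ (normalCovariance L M sC) (hubbardInteractionCT L M β U K)) -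
          gaussConv ℂ D (effAction ℂ (normalCovariance L M sC) (hubbardInteractionCT L M β U K))) 4 Z -
        (kernel ℂ (gaussConv ℂ (D + normalCovariance L M sd)
            (effAction ℂ (normalCovariance L M sC) (hubbardInteractionCT L M β U K) - gaussConv ℂ (normalCovariance L M sC) (hubbardInteractionCT L M β U K) +
              (2 : ℂ)⁻¹ • (gaussConv ℂ (normalCovariance L M sC) (hubbardInteractionCT L M β U K * hubbardInteractionCT L M β U K) -
                gaussConv ℂ (normalCovariance L M sC) (hubbardInteractionCT L M β U K) *
                  gaussConv ℂ (normalCovariance L M sC) (hubbardInteractionCT L M β U K)))) 4 Z -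
          kernel ℂ (gaussConv ℂ D
            (effAction ℂ (normalCovariance L M sC) (hubbardInteractionCT L M β U K) - gaussConv ℂ (normalCovariance L M sC) (hubbardInteractionCT L M β U K) +
              (2 : ℂ)⁻¹ • (gaussConv ℂ (normalCovariance L M sC) (hubbardInteractionCT L M β U K * hubbardInteractionCT L M β U K) -
                gaussConv ℂ (normalCovariance L M sC) (hubbardInteractionCT L M β U K) *
                  gaussConv ℂ (normalCovariance L M sC) (hubbardInteractionCT L M β U K)))) 4 Z)‖ ≤
      960 * (|U| / |β * (L : ℝ) ^ 2| ^ 3 / 24) ^ 2 * SC * ∑ p, ‖sd p‖ := by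
  set cU : ℝ := |U| / |β * (L : ℝ) ^ 2| ^ 3 / 24 with hcU
  set m : ℝ := cU ^ 2 * SC * ∑ p, ‖sd p‖ with hm
  have hcU0 : 0 ≤ cU := by positivity
  have hSC0 : 0 ≤ SC := (norm_nonneg _).trans (hSC ((omega0 M, 0), 0))
  have hm0 : 0 ≤ m := by positivity
  rw [kernel_four_gaussConv_add_effAction_sub, add_sub_cancel_right, norm_neg]
  -- the four trees and the three bubbles
  have t0 := norm_oneLineTree_le β U K sC sd hSC (Z 0) (Z 1) (Z 2) (Z 3)
  have t1 := norm_oneLineTree_le β U K sC sd hSC (Z 1) (Z 0) (Z 2) (Z 3)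
  have t2 := norm_oneLineTree_le β U K sC sd hSC (Z 2) (Z 0) (Z 1) (Z 3)
  have t3 := norm_oneLineTree_le β U K sC sd hSC (Z 3) (Z 0) (Z 1) (Z 2)
  have b1 := norm_softHardBubble_le β U sC sd hSC (Z 2) (Z 3) (Z 0) (Z 1)
  have b2 := norm_softHardBubble_le β U sC sd hSC (Z 0) (Z 3) (Z 1) (Z 2)
  have b3 := norm_softHardBubble_le β U sC sd hSC (Z 0) (Z 2) (Z 1) (Z 3)
  rw [← hcU] at t0 t1 t2 t3 b1 b2 b3
  have h2 : ‖(2 : ℂ)⁻¹‖ = 2⁻¹ := by simp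
  have h4 : ‖(4 : ℂ)‖ = 4 := by simp
  have h24 : ‖(2 * (Nat.factorial 4 : ℂ))‖ = 48 := by norm_num [Nat.factorial]
  -- triangle inequalities
  calc _ ≤ 2⁻¹ * (4 * (48 * m + 48 * m + 48 * m + 48 * m) + 48 * (8 * m + 8 * m + 8 * m)) := by
        rw [norm_mul, h2]
        refine mul_le_mul_of_nonneg_left ?_ (by norm_num)
        refine (norm_add_le _ _).trans (add_le_add ?_ ?_)
        · rw [norm_mul, h4]
          refine mul_le_mul_of_nonneg_left ?_ (by norm_num)
          refine (norm_add_le _ _).trans (add_le_add ((norm_sub_le _ _).trans (add_le_add ((norm_add_le _ _).trans (add_le_add ?_ ?_)) ?_)) ?_)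
          · rw [norm_neg]; exact t0.trans (le_of_eq (by rw [hm]; ring))
          · exact t1.trans (le_of_eq (by rw [hm]; ring))
          · exact t2.trans (le_of_eq (by rw [hm]; ring))
          · exact t3.trans (le_of_eq (by rw [hm]; ring))
        · rw [norm_neg, norm_mul, h24]
          refine mul_le_mul_of_nonneg_left ?_ (by norm_num)
          refine (norm_sub_le _ _).trans (add_le_add ((norm_add_le _ _).trans (add_le_add ?_ ?_)) ?_)
          · exact b1.trans (le_of_eq (by rw [hm]; ring))
          · exact b2.trans (le_of_eq (by rw [hm]; ring))
          · exact b3.trans (le_of_eq (by rw [hm]; ring))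
    _ = 960 * cU ^ 2 * SC * ∑ p, ‖sd p‖ := by rw [hm]; ring

/-! ## §5 At the pair legs, in vertex-function units -/

/-- **THE SECOND-ORDER MEMBER DIFFERENCE OF THE SCALE-`0` PAIR AMPLITUDE** (cure (β), explicit part): with the hard covariance in normal form
`C^K_{>e₀} = normalCovariance s_C` (`‖s_C p‖ ≤ S_C`), a smearing `D` and a member step `d = normalCovariance s_d`,
`‖𝒜₀[D + d] − 𝒜₀[D] − 4!(βL²)³·(tail at the pair legs)‖ ≤ 40·U²·S_C·(Σ_p‖s_d p‖)/|βL²|³` — the hard line by its SUP, the soft step by its ENTRY SUM;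
no position-space constant. [cite: BenfattoGiulianiMastropietro2006, §2.2 (2.12)-(2.14)] -/
theorem norm_klCovSmearedPairAmplitude_zero_add_sub_sub_tail_le (β U μ : ℝ) (K : TrigPolyC4v) (sC sd : FreqMomentum L M × Fin 2 → ℂ)
    {SC : ℝ} (hSC : ∀ p, ‖sC p‖ ≤ SC) (hC : hubbardCovAboveCT L M β μ 0 K (klScale klE0 0) = normalCovariance L M sC)
    (D : Matrix (HubbardFieldIdx L M) (HubbardFieldIdx L M) ℂ) (Qm k k' : TorusSite 2 L) :
    ‖klCovSmearedPairAmplitude L M β U μ K 0 (D + normalCovariance L M sd) Qm k k' - klCovSmearedPairAmplitude L M β U μ K 0 D Qm k k' -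
        ((((4 : ℕ).factorial : ℝ) * (β * (L : ℝ) ^ 2) ^ (4 - 1) : ℝ) : ℂ) *
          (kernel ℂ (gaussConv ℂ (D + normalCovariance L M sd)
              (effAction ℂ (normalCovariance L M sC) (hubbardInteractionCT L M β U K) - gaussConv ℂ (normalCovariance L M sC) (hubbardInteractionCT L M β U K) +
                (2 : ℂ)⁻¹ • (gaussConv ℂ (normalCovariance L M sC) (hubbardInteractionCT L M β U K * hubbardInteractionCT L M β U K) -
                  gaussConv ℂ (normalCovariance L M sC) (hubbardInteractionCT L M β U K) *
                    gaussConv ℂ (normalCovariance L M sC) (hubbardInteractionCT L M β U K)))) 4 (pairLegs L M Qm k k') -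
            kernel ℂ (gaussConv ℂ D
              (effAction ℂ (normalCovariance L M sC) (hubbardInteractionCT L M β U K) - gaussConv ℂ (normalCovariance L M sC) (hubbardInteractionCT L M β U K) +
                (2 : ℂ)⁻¹ • (gaussConv ℂ (normalCovariance L M sC) (hubbardInteractionCT L M β U K * hubbardInteractionCT L M β U K) -
                  gaussConv ℂ (normalCovariance L M sC) (hubbardInteractionCT L M β U K) *
                    gaussConv ℂ (normalCovariance L M sC) (hubbardInteractionCT L M β U K)))) 4 (pairLegs L M Qm k k'))‖ ≤
      40 * U ^ 2 * SC * (∑ p, ‖sd p‖) / |β * (L : ℝ) ^ 2| ^ 3 := by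
  have hSC0 : 0 ≤ SC := (norm_nonneg _).trans (hSC ((omega0 M, 0), 0))
  rw [klCovSmearedPairAmplitude_zero_add_sub_eq, hC, ← mul_sub, norm_mul, Complex.norm_real, Real.norm_eq_abs]
  have h := norm_kernel_four_gaussConv_add_effAction_sub_sub_tail_le β U K sC sd hSC D (pairLegs L M Qm k k')
  have hfac : |(((4 : ℕ).factorial : ℝ) * (β * (L : ℝ) ^ 2) ^ (4 - 1))| = 24 * |β * (L : ℝ) ^ 2| ^ 3 := by
    rw [abs_mul, abs_pow]; norm_num [Nat.factorial]
  rw [hfac]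
  by_cases hβL : β * (L : ℝ) ^ 2 = 0
  · have : |β * (L : ℝ) ^ 2| = 0 := by rw [hβL, abs_zero]
    rw [this]
    simp
  have hpos : 0 < |β * (L : ℝ) ^ 2| := abs_pos.2 hβL
  calc 24 * |β * (L : ℝ) ^ 2| ^ 3 * _ ≤ 24 * |β * (L : ℝ) ^ 2| ^ 3 * (960 * (|U| / |β * (L : ℝ) ^ 2| ^ 3 / 24) ^ 2 * SC * ∑ p, ‖sd p‖) :=
        mul_le_mul_of_nonneg_left h (by positivity)
    _ = 40 * U ^ 2 * SC * (∑ p, ‖sd p‖) / |β * (L : ℝ) ^ 2| ^ 3 := by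
        rw [show U ^ 2 = |U| ^ 2 by rw [sq_abs]]
        field_simp
        ring

end Summit.HubbardSuperconductivity.HubbardSuperconductivity.Theorems.EngineV8

end
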